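import Summits.RiemannHypothesis.RiemannHypothesis.Theorems.CCRouteAdapters
import Literature.NumberTheory.ConnesConsani2021.ArchimedeanTraceFormulaProofs
import Literature.NumberTheory.ConnesConsani2021.ProlateProjectionsCompleteness
import HarnessLib

/-!
# Route «ConnesConsaniSemilocal», crux K1 `SoninTraceFormula` (stmt-RiemannHypothesis-19305) — CONDITIONAL closer

RH-FREE bookkeeping of an RH-free corpus statement (cell `rh-crit/cc`, seat `rh-crit-cc-iso` g4; recipe of
record cc-lead R51/R65 and BOUNDARY LEDGER v3: «K1 ⇐ {`CC2021_prop_2_2_iii`, `CC2021_sec4_xi_complete`} via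
t4 g2 p430212 `CC2021_thm_4_7_weak_of_prop_2_2_iii_of_xi_complete`, recipe
`soninTraceFormula_iff_thm_4_7_weak.mpr (…)`»).  K1 says: Connes–Consani 2021 Thm. 4.7 in weak trace form —
for every archimedean density `G`, every Weil test `g` and every finite orthonormal family `ξ_i` in Sonin's space
`S(1,1)`, `Σ_i Re⟨ξ_i|ϑ(g ∗ g*)ξ_i⟩ ≤ Re W_∞(g ∗ g*) + Re E_G(g ∗ g*)`; by the route adapter
`CCRouteAdapters.soninTraceFormula_iff_thm_4_7_weak` it IS the corpus fact `CC2021_thm_4_7_weak`.  The second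
boundary fact is now a tree THEOREM (`CC2021_sec4_xi_complete_holds`, t10 p432462: completeness of the even
prolate basis of `𝒫₁L²(ℝ)_ev`, via t3's Slepian commutation `ProlateCommutation.lean`), so K1 is a theorem
CONDITIONAL on exactly ONE named fact, `CC2021_prop_2_2_iii` (Connes–Consani 2021 Prop. 2.2 (iii): the local
trace formula `Tr(ϑ(f)P𝒫̂P) = W_∞(f) + ∫ f(ρ⁻¹)δ(ρ)d*ρ`, typed as an `IsLUB` over finite orthonormal
families of `P̂L²(ℝ)_ev`; FROZEN-XL in the cell's FACT-LIST, discharge track gm-t15/t1 (k-4c)).  A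
`conditional-result` for the gate; the item closes unconditionally the hour `CC2021_prop_2_2_iii` is discharged.
WHAT THIS IS NOT: any claim about RH — the leaf `WeilArchPositivity_soninTrace_fine` this binder serves is RH-FREE
and not RH-detecting; the residual `IsolatedCC` is RH-EQUIVALENT and untouched.  Nothing here bears on the truth
of RH.
-/

-- `Summit.RiemannHypothesis.RiemannHypothesis.…` duplicates `RiemannHypothesis` BY DESIGN (D-0017).
set_option linter.dupNamespace false

namespace Summit.RiemannHypothesis.RiemannHypothesis.Theorems.CCRouteAdapters

open Literature.NumberTheory.LFunctions Literature.NumberTheory.ConnesConsani2021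

/-- RH-FREE. **K1 `SoninTraceFormula` from Prop. 2.2 (iii)** (route «ConnesConsaniSemilocal», item
stmt-RiemannHypothesis-19305), CONDITIONAL on the one named fact `CC2021_prop_2_2_iii`: the weak Thm. 4.7
— t4's one-hypothesis corollary `CC2021_thm_4_7_weak_of_prop_2_2_iii` (p433103: the two-hypothesis form with the
completeness of the even prolate basis discharged by the tree theorem `CC2021_sec4_xi_complete_holds`, [Slepian]) —
transported to the route item by the K1 adapter `soninTraceFormula_of_thm_4_7_weak`.  Its type is LITERALLY the route
decl.
[cite: ConnesConsani2021, Thm. 4.7 §4 p. 18 (= arXiv Thm. 27); Prop. 2.2 (iii) §2 p. 10] -/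
theorem soninTraceFormula_of_prop_2_2_iii (h : CC2021_prop_2_2_iii) :
    Summit.RiemannHypothesis.RiemannHypothesis.Theses.ConnesConsaniSemilocal.SoninTraceFormula :=
  soninTraceFormula_of_thm_4_7_weak (CC2021_thm_4_7_weak_of_prop_2_2_iii h)

/-- RH-FREE. **The RH-FREE rung leaf from the ONE analytic fact plus the three other route items**: with K1 fed
by Prop. 2.2 (iii), the route's deciding theorem `closes` needs only K0 `DensityRegular`, K2 `DensitySlope`,
K3 `WindowSpectralBound` (each of which has its own landed conditional closer).  Recorded to certify the
composition; NOT RH-detecting. [cite: ConnesConsani2021, eq. (4) p. 4; Thm. 6.11 §6.7 pp. 28–29] -/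
theorem leaf_of_prop_2_2_iii (h : CC2021_prop_2_2_iii)
    (h₀ : Summit.RiemannHypothesis.RiemannHypothesis.Theses.ConnesConsaniSemilocal.DensityRegular)
    (h₂ : Summit.RiemannHypothesis.RiemannHypothesis.Theses.ConnesConsaniSemilocal.DensitySlope)
    (h₃ : Summit.RiemannHypothesis.RiemannHypothesis.Theses.ConnesConsaniSemilocal.WindowSpectralBound) :
    WeilArchPositivity_soninTrace_fine :=
  Summit.RiemannHypothesis.RiemannHypothesis.Theses.ConnesConsaniSemilocal.closes h₀
    (soninTraceFormula_of_prop_2_2_iii h) h₂ h₃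

end Summit.RiemannHypothesis.RiemannHypothesis.Theorems.CCRouteAdapters
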